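import Mathlib
import Literature.NumberTheory.DiophantineApproximation.SimultaneousApproxComplexity
import Literature.Computability.Complexity.CanonicalCodes
import Literature.Computability.Complexity.CodeFPRat
import Literature.Computability.Complexity.CodeFPArith
import Literature.Computability.Complexity.StringEquality
import HarnessLib

/-!
# GSA codes: the typed form of the encoding and polynomial-time canonicalisation

Topic `NumberTheory/DiophantineApproximation`; machine-level groundwork for the discharge of
`Lagarias1985_gsaOfDim_mem_P` (`SimultaneousApproxComplexity.lean`: GSA in fixed dimension is in `P`).
A language `e.toLanguage S` is the IMAGE of `S` under the code, so a decision procedure for it must,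
besides deciding `S` on genuine codes, reject the strings that are not codes; the tree's idiom
(`NumberFieldIsomorphismPProofs.range_encode_mem_P`, `CanonicalCodes.lean`) is to exhibit the range of
the code as the fixed points of a polynomial-time CANONICALISATION `w ↦ encode (decode w)` for a total
decoder. This file provides that for the GSA encoding
`SimultaneousApproxInstance.encoding = intVecEncoding.pairBool (encodingNatBool.pairBool (encodingNatBool.pairBool encodingRatBool))`:

* `tupleE`, `toTuple`, `encode_eq_tupleE` — the code of `I = (⟨d, a⟩, b, N, ε)` is the `CodeFP` tuple code
  `pairE (pairE natE (listE smE)) (pairE natE (pairE natE encodeRat))` of `((d, [a₀, …, a_{d-1}]), (b, (N, ε)))`;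
* `decTuple` — a TOTAL reading of any string as such a tuple (dimension := number of items read, as
  the tree's `listBoolDecode` does; integers by `CanonCode.decInt`, naturals by `decodeNat`, the
  rational as `decInt num / decodeNat den`), `decTuple_codeFP : CodeFP strE tupleE decTuple` (the
  canonicalisation `canon = tupleE ∘ decTuple` is an `FP` string function, assembled from
  `CanonCode.canonListFn canonIntFn`, `Brick.canonF`, `CodeFP.ratOfIntNat`), `decTuple_encode`
  (`decTuple (encode I) = toTuple I`);
* `ofTuple`, `encode_ofTuple_decTuple` (`encode (ofTuple (decTuple w)) = tupleE (decTuple w)`), and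
  `mem_range_encode_iff : w ∈ range encode ↔ tupleE (decTuple w) = w`, `range_encode_mem_P`.

## References

* S. Arora, B. Barak, *Computational Complexity: A Modern Approach*, CUP 2009, §0.1 (codes of
  tuples and lists), §1.3 (closure of polynomial time under composition). [AroraBarak2009]
* J. C. Lagarias, SIAM J. Comput. 14 (1985) 196–209 (the problem GSA). [Lagarias1985]
-/

namespace Literature.NumberTheory.DiophantineApproximation

open _root_.Computability
open Literature.Computability.Complexity Literature.Computability.Complexity.CodeFP
open Literature.Computability.Complexity.Brick (canonF canonF_mem_FP canonF_eq_encodeNat_decodeNat fstF sndF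
  fstF_mem_FP sndF_mem_FP)
open Literature.Computability.Complexity.CanonCode (decInt decode_int canonIntFn canonIntFn_mem_FP
  canonIntFn_eq length_canonIntFn_le canonListFn canonListFn_mem_FP canonListFn_eq)
open Literature.Algebra.EuclideanLattices (encodeRat intVecEncoding encodingIntVecFin encodingRatBool)

namespace SimultaneousApproxInstance

/-! ### The code of an instance as a typed tuple code -/

/-- The tuple type behind a GSA code: `((d, [a₀, …, a_{d-1}]), (b, (N, ε)))`. [folklore] -/
abbrev Tuple : Type := (ℕ × List ℤ) × (ℕ × (ℕ × ℚ))

/-- The tuple code: binary `d`, headed list of sign–magnitude integers, binary `b`, binary `N`, the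
rational `ε` as (sign–magnitude numerator, binary denominator). [cite: AroraBarak2009, §0.1] -/
def tupleE : Tuple → List Bool :=
  pairE (pairE natE (listE smE)) (pairE natE (pairE natE encodeRat))

/-- The tuple of an instance. [folklore] -/
def toTuple (I : SimultaneousApproxInstance) : Tuple :=
  ((I.dim, List.ofFn I.num), (I.den, (I.bound, I.eps)))

/-- **The GSA code is the tuple code of the tuple of the instance.** [cite: AroraBarak2009, §0.1] -/
theorem encode_eq_tupleE (I : SimultaneousApproxInstance) : encoding.encode I = tupleE I.toTuple := by
  obtain ⟨⟨d, a⟩, b, N, ε⟩ := I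
  change boolPair (boolPair (encodeNat d) (encodingIntBool.listBool.encode (List.ofFn a)))
      (boolPair (encodeNat b) (boolPair (encodeNat N) (encodeRat ε))) = _
  rw [listE_eq]
  rfl

/-- The tuple code is injective on tuples of instances (it is the instance code). [folklore] -/
theorem toTuple_injective : Function.Injective toTuple := fun I J h => by
  apply encoding.encode_injective
  rw [encode_eq_tupleE, encode_eq_tupleE, h]

/-! ### Total decoding of arbitrary strings -/

/-- The integer list read off the `intVecEncoding` part `u = ⟨header, ⟨1ᵏ, items⟩⟩` of a string: `k`
items of `items`, each by the total integer decoder `decInt` (the header is ignored: on a genuine code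
it equals `k`). [folklore] -/
def decIntList (u : List Bool) : List ℤ :=
  NegCNF.decList decInt (boolUnpair (boolUnpair u).2).1.length (boolUnpair (boolUnpair u).2).2

/-- **The total decoder**: any string read as a GSA tuple (dimension := number of integers read).
[folklore] -/
def decTuple (w : List Bool) : Tuple :=
  (((decIntList (boolUnpair w).1).length, decIntList (boolUnpair w).1),
    (decodeNat (boolUnpair (boolUnpair w).2).1,
      (decodeNat (boolUnpair (boolUnpair (boolUnpair w).2).2).1,
        (decInt (boolUnpair (boolUnpair (boolUnpair (boolUnpair w).2).2).2).1 : ℚ) /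
          decodeNat (boolUnpair (boolUnpair (boolUnpair (boolUnpair w).2).2).2).2)))

/-- The total integer decoder reads back sign–magnitude codes. [folklore] -/
theorem decInt_smE (z : ℤ) : decInt (smE z) = z := by
  have h := decode_int (smE z)
  rw [show smE z = encodingIntBool.encode z from rfl, encodingIntBool.decode_encode] at h
  exact (Option.some.inj h).symm

/-- `decList decInt k` reads back the items of a raw list of `k` sign–magnitude integers. [folklore] -/
theorem decList_rawE_smE (l : List ℤ) : NegCNF.decList decInt l.length (rawE smE l) = l := by
  induction l with
  | nil => rfl
  | cons z l ih =>
    rw [List.length_cons, NegCNF.decList, rawE_cons, boolUnpair_boolPair]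
    simp only [ih, decInt_smE]

/-- `decIntList` reads back the code of an integer vector. [folklore] -/
theorem decIntList_boolPair (d : ℕ) (l : List ℤ) : decIntList (boolPair (natE d) (listE smE l)) = l := by
  rw [decIntList, boolUnpair_boolPair]
  simp only [listE, boolUnpair_boolPair, length_unE, decList_rawE_smE]

/-- **The decoder inverts the code**: `decTuple (encode I) = toTuple I`. [folklore] -/
theorem decTuple_encode (I : SimultaneousApproxInstance) : decTuple (encoding.encode I) = I.toTuple := by
  rw [encode_eq_tupleE, toTuple, tupleE, pairE_apply, decTuple, boolUnpair_boolPair]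
  simp only [pairE_apply, decIntList_boolPair, List.length_ofFn, boolUnpair_boolPair, decode_encodeNat,
    encodeRat_eq_pairE, decInt_smE, Rat.num_div_den]

/-! ### The canonicalisation is polynomial time -/

/-- Naturals are read in polynomial time: `canonF = natE ∘ decodeNat`. [folklore] -/
theorem decodeNat_codeFP : CodeFP strE natE decodeNat :=
  of_fn canonF canonF_mem_FP fun w => canonF_eq_encodeNat_decodeNat w

/-- Integers are read in polynomial time: `canonIntFn = smE ∘ decInt`. [folklore] -/
theorem decInt_codeFP : CodeFP strE smE decInt :=
  of_fn canonIntFn canonIntFn_mem_FP fun w => canonIntFn_eq w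

/-- Integer lists are read in polynomial time: `canonListFn canonIntFn` re-encodes the `listBool` part.
[cite: AroraBarak2009, §1.3] -/
theorem decIntList_codeFP : CodeFP strE (listE smE) decIntList := by
  have h : CodeFP strE (listE smE) (fun body => NegCNF.decList decInt (boolUnpair body).1.length (boolUnpair body).2) :=
    of_fn (canonListFn canonIntFn) (canonListFn_mem_FP canonIntFn_mem_FP length_canonIntFn_le) fun body => by
      change canonListFn canonIntFn body = _
      rw [(canonListFn_eq encodingIntBool decInt decode_int canonIntFn_eq body).2, listE_eq]; rfl
  have hsnd : CodeFP strE strE (fun w => (boolUnpair w).2) := of_fn sndF sndF_mem_FP fun _ => rfl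
  exact (h.comp hsnd).congr fun _ => rfl

/-- **The canonicalisation `tupleE ∘ decTuple` is an `FP` string function.** [cite: AroraBarak2009, §1.3] -/
theorem decTuple_codeFP : CodeFP strE tupleE decTuple := by
  -- the two halves of a string under `boolUnpair` are the bricks `fstF`, `sndF`
  -- (as in `Regev2009.GIVPPost.fstStr_codeFP`, not imported for one line)
  have unpairFst_codeFP : CodeFP strE strE (fun w => (boolUnpair w).1) := of_fn fstF fstF_mem_FP fun _ => rfl
  have unpairSnd_codeFP : CodeFP strE strE (fun w => (boolUnpair w).2) := of_fn sndF sndF_mem_FP fun _ => rfl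
  have hL : CodeFP strE (listE smE) (fun w => decIntList (boolUnpair w).1) := decIntList_codeFP.comp unpairFst_codeFP
  have hlen : CodeFP strE natE (fun w => (decIntList (boolUnpair w).1).length) :=
    ((natLength smE).comp ((rawOfList smE).comp hL)).congr fun _ => rfl
  have hr : CodeFP strE strE (fun w => (boolUnpair w).2) := unpairSnd_codeFP
  have hb : CodeFP strE natE (fun w => decodeNat (boolUnpair (boolUnpair w).2).1) :=
    decodeNat_codeFP.comp (unpairFst_codeFP.comp hr)
  have hr2 : CodeFP strE strE (fun w => (boolUnpair (boolUnpair w).2).2) := unpairSnd_codeFP.comp hr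
  have hN : CodeFP strE natE (fun w => decodeNat (boolUnpair (boolUnpair (boolUnpair w).2).2).1) :=
    decodeNat_codeFP.comp (unpairFst_codeFP.comp hr2)
  have hr3 : CodeFP strE strE (fun w => (boolUnpair (boolUnpair (boolUnpair w).2).2).2) := unpairSnd_codeFP.comp hr2
  have hnum : CodeFP strE intE (fun w => decInt (boolUnpair (boolUnpair (boolUnpair (boolUnpair w).2).2).2).1) :=
    intOfSM.comp (decInt_codeFP.comp (unpairFst_codeFP.comp hr3))
  have hden : CodeFP strE natE (fun w => decodeNat (boolUnpair (boolUnpair (boolUnpair (boolUnpair w).2).2).2).2) :=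
    decodeNat_codeFP.comp (unpairSnd_codeFP.comp hr3)
  have heps := ratOfIntNat.comp (hnum.pair hden)
  exact ((hlen.pair hL).pair (hb.pair (hN.pair heps))).congr fun _ => rfl

/-! ### The range of the code -/

/-- The instance of a tuple (dimension := length of the list; the header is ignored). [folklore] -/
def ofTuple (t : Tuple) : SimultaneousApproxInstance :=
  (⟨t.1.2.length, fun i => t.1.2.get i⟩, t.2.1, t.2.2.1, t.2.2.2)

/-- The tuple of the instance of a tuple: the header is replaced by the length. [folklore] -/
theorem toTuple_ofTuple (t : Tuple) : (ofTuple t).toTuple = ((t.1.2.length, t.1.2), t.2) := by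
  obtain ⟨⟨d, l⟩, b, N, ε⟩ := t
  change ((l.length, List.ofFn l.get), (b, (N, ε))) = ((l.length, l), (b, (N, ε)))
  rw [List.ofFn_get]

/-- On decoded tuples the header IS the length, so `ofTuple` loses nothing. [folklore] -/
theorem toTuple_ofTuple_decTuple (w : List Bool) : (ofTuple (decTuple w)).toTuple = decTuple w := by
  rw [toTuple_ofTuple]; rfl

/-- Hence the canonicalisation lands in the range of the code:
`encode (ofTuple (decTuple w)) = tupleE (decTuple w)`. [folklore] -/
theorem encode_ofTuple_decTuple (w : List Bool) :
    encoding.encode (ofTuple (decTuple w)) = tupleE (decTuple w) := by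
  rw [encode_eq_tupleE, toTuple_ofTuple_decTuple]

/-- `ofTuple` inverts `toTuple`. [folklore] -/
theorem ofTuple_toTuple (I : SimultaneousApproxInstance) : ofTuple I.toTuple = I :=
  toTuple_injective (by rw [toTuple_ofTuple]; simp [toTuple])

/-- **The range of the GSA code is the fixed-point set of the canonicalisation.** [cite: AroraBarak2009, §0.1 and §1.3] -/
theorem mem_range_encode_iff (w : List Bool) :
    w ∈ Set.range encoding.encode ↔ tupleE (decTuple w) = w := by
  constructor
  · rintro ⟨I, rfl⟩
    rw [decTuple_encode, encode_eq_tupleE]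
  · intro h
    exact ⟨ofTuple (decTuple w), (encode_ofTuple_decTuple w).trans h⟩

/-- **The set of GSA codes is in `P`** (an equaliser of two `FP` functions). [cite: AroraBarak2009, §1.3] -/
theorem range_encode_mem_P : Set.range encoding.encode ∈ Classes.P := by
  obtain ⟨f, hf, hfw⟩ := decTuple_codeFP
  have h : Set.range encoding.encode = {w | f w = id w} := by
    ext w
    have hw : f w = tupleE (decTuple w) := hfw w
    rw [mem_range_encode_iff, Set.mem_setOf_eq, hw]
    rfl
  rw [h]
  exact setOf_apply_eq_apply_mem_P hf (PolyTimeComputable.id _)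

end SimultaneousApproxInstance

end Literature.NumberTheory.DiophantineApproximation
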